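import Mathlib
import Summits.HodgeConjecture.HodgeConjecture.Theorems.TropicalWeilObstructionTropicalWeilVanishingRealisationSystem

/-!
# Route `TropicalWeilObstruction` (Kontsevich's tropical test — NEGATION SINK, exploration, no summit claim):
# an unobstructed `W ≠ 0` seed at ANY rational base period yields a `W ≠ 0` effective cycle at a very general period (every `n`)

Negation-sink bookkeeping of the cell `pub-hodge-tropical` (seat tropical-2 gen 7). The identity criterion of line
`identity_transfer` (`…TropicalWeilVanishingIdentityCriterion`, p314377: `tropicalWeilVanishing_false_of_unobstructedSeed`, `n = 4`,
base period `1`) in the form needed by the `n = 2` CALIBRATION of K1: for every `n`, every symmetric `J`-commuting base period `Q₀`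
at which Weil-generic positive definite `J`-commuting periods ACCUMULATE, and every effective tropical `n`-cycle `Z₀` on `ℝ²ⁿ/Q₀ℤ²ⁿ` with
`W(Z₀) ≠ 0` whose combinatorial type is LINEARLY REALISABLE in every direction of `Sym_J` (p313252's `linearSpread` hypothesis), there is a
Weil-generic positive definite `J`-commuting period `Q` carrying an effective tropical `n`-cycle with `W ≠ 0` — i.e. the `n`-dimensional
analogue of K1 FAILS. (`linearSpread` gives continuous families of real data realising the type over all of `Sym_J`; positivity of the
edge determinants and `W ≠ 0` are open conditions holding at `Q₀`.)

HONEST STATUS. A re-packaging of p313252/p314377 for general `n` and base period; decides nothing about K1 (`n = 4`, OPEN) or about the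
Hodge conjecture. No definition, no named fact, no sorry.
References: [Zharkov2020TropicalWeil] I. Zharkov, arXiv:2002.02347, §1–2 (pp. 2–4); [MikhalkinZharkov2014Eigenwave] G. Mikhalkin,
I. Zharkov, LN UMI 15 (2014), Def. 4.2, Prop. 4.3.
-/

set_option linter.dupNamespace false

noncomputable section

open scoped BigOperators Matrix Topology
open Matrix Literature.AlgebraicGeometry.Tropical

namespace Summit.HodgeConjecture.HodgeConjecture.Theorems.TropicalWeilVanishing

/-- **An unobstructed `W ≠ 0` seed at a base period where generic periods accumulate refutes the `n`-dimensional analogue of K1.**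
If `Q₀` is symmetric and `J`-commuting, every neighbourhood of `Q₀` contains a Weil-generic positive definite `J`-commuting period, and
`Z₀` is an effective tropical `n`-cycle on `ℝ²ⁿ/Q₀ℤ²ⁿ` with `W(Z₀) ≠ 0` whose combinatorial type is linearly realisable in every direction
of `Sym_J`, then some Weil-generic positive definite `J`-commuting `Q` carries an effective tropical `n`-cycle `Z` with `W(Z) ≠ 0`
(same cells' weights, frames and facet pattern as `Z₀`). [cite: Zharkov2020TropicalWeil, §1–2 (pp. 2–4)] -/
theorem exists_weilGeneric_weilFunctional_ne_zero_of_unobstructedSeed {n : ℕ}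
    {Q₀ : Matrix (Fin (2 * n)) (Fin (2 * n)) ℝ} (hQ₀S : Q₀.IsSymm) (hQ₀J : Q₀ * weilJ n = weilJ n * Q₀)
    (hacc : ∀ U : Set (Matrix (Fin (2 * n)) (Fin (2 * n)) ℝ), IsOpen U → Q₀ ∈ U →
      ∃ Q ∈ U, Q.PosDef ∧ Q * weilJ n = weilJ n * Q ∧ IsWeilGeneric n Q)
    (Z₀ : TropicalTorusCycle (2 * n) n Q₀) (hW : weilFunctional Z₀ ≠ 0)
    (hsec : ∀ D : Matrix (Fin (2 * n)) (Fin (2 * n)) ℝ, D.IsSymm → D * weilJ n = weilJ n * D →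
      ∃ (v : Fin Z₀.numCells → Fin (n + 1) → Fin (2 * n) → ℝ)
        (T : Fin Z₀.numCells → Matrix (Fin n) (Fin n) ℝ)
        (r : Fin Z₀.numFacetClasses → Fin n → Fin (2 * n) → ℝ),
        (∀ (σ : Fin Z₀.numCells) (j : Fin n) (a : Fin (2 * n)),
            v σ j.succ a - v σ 0 a = ∑ m, ((Z₀.cell σ).frame a m : ℝ) * T σ m j) ∧
        (∀ (σ : Fin Z₀.numCells) (i : Fin (n + 1)) (j : Fin n) (a : Fin (2 * n)),
            v σ (i.succAbove (Z₀.facetPerm σ i j)) a =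
              r (Z₀.facetClass σ i) j a + ∑ b, D a b * (Z₀.facetShift σ i b : ℝ))) :
    ∃ Q : Matrix (Fin (2 * n)) (Fin (2 * n)) ℝ, Q.PosDef ∧ Q * weilJ n = weilJ n * Q ∧ IsWeilGeneric n Q ∧
      ∃ Z : TropicalTorusCycle (2 * n) n Q, Z.numCells = Z₀.numCells ∧ weilFunctional Z ≠ 0 := by
  obtain ⟨V, T, Rf, hTcont, hT1, hreal⟩ := linearSpread hQ₀S hQ₀J Z₀ hsec
  -- the open set `U ∋ Q₀`: positive edge determinants and non-zero Weil expression
  set U : Set (Matrix (Fin (2 * n)) (Fin (2 * n)) ℝ) := {P | (∀ σ, 0 < (T P σ).det) ∧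
    (∑ σ, ((Z₀.cell σ).weight : ℂ) * (((T P σ).det / ((n : ℕ).factorial : ℝ) : ℝ) : ℂ) *
      frameComplexDet n (Z₀.cell σ).frame ^ 2) ≠ 0} with hU
  have hUopen : IsOpen U := by
    have h1 : IsOpen {P : Matrix (Fin (2 * n)) (Fin (2 * n)) ℝ | ∀ σ, 0 < (T P σ).det} := by
      rw [Set.setOf_forall]
      exact isOpen_iInter_of_finite fun σ => isOpen_lt continuous_const (hTcont σ).matrix_det
    have h2 : IsOpen {P : Matrix (Fin (2 * n)) (Fin (2 * n)) ℝ |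
        (∑ σ, ((Z₀.cell σ).weight : ℂ) * (((T P σ).det / ((n : ℕ).factorial : ℝ) : ℝ) : ℂ) *
          frameComplexDet n (Z₀.cell σ).frame ^ 2) ≠ 0} := by
      refine isOpen_ne_fun ?_ continuous_const
      refine continuous_finsetSum _ fun σ _ => ?_
      exact (continuous_const.mul (Complex.continuous_ofReal.comp
        ((hTcont σ).matrix_det.div_const _))).mul continuous_const
    exact h1.inter h2
  have h0U : Q₀ ∈ U := by
    refine ⟨fun σ => by rw [hT1 σ]; exact (Z₀.cell σ).edgeCoeff_det_pos, ?_⟩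
    have e : (∑ σ, ((Z₀.cell σ).weight : ℂ) * (((T Q₀ σ).det / ((n : ℕ).factorial : ℝ) : ℝ) : ℂ) *
        frameComplexDet n (Z₀.cell σ).frame ^ 2) = weilFunctional Z₀ := by
      unfold weilFunctional TropicalCell.latticeVolume
      exact Finset.sum_congr rfl fun σ _ => by rw [hT1 σ]
    rw [e]; exact hW
  -- a Weil-generic positive definite period in `U`, and the realisation over it
  obtain ⟨Q, hQU, hQ, hQJ, hgen⟩ := hacc U hUopen h0U
  have hQS : Q.IsSymm := by
    have h := hQ.1
    rw [Matrix.IsHermitian, Matrix.conjTranspose_eq_transpose_of_trivial] at h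
    exact h
  obtain ⟨hv, hfe⟩ := hreal Q hQS hQJ
  refine ⟨Q, hQ, hQJ, hgen,
    { numCells := Z₀.numCells
      cell := fun σ =>
        { weight := (Z₀.cell σ).weight
          weight_pos := (Z₀.cell σ).weight_pos
          vertex := V Q σ
          frame := (Z₀.cell σ).frame
          edgeCoeff := T Q σ
          vertex_succ_sub := hv σ
          edgeCoeff_det_pos := hQU.1 σ
          frame_saturated := (Z₀.cell σ).frame_saturated }
      numFacetClasses := Z₀.numFacetClasses
      refFacet := Rf Q
      facetClass := Z₀.facetClass
      facetPerm := Z₀.facetPerm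
      facetShift := Z₀.facetShift
      facet_eq := hfe
      balanced := Z₀.balanced }, rfl, ?_⟩
  exact hQU.2

/-- **Finitely many directions suffice (any `n`, any base period).** If the linearised realisation system of the type of `Z₀` is solved
in each direction of a finite family `E` whose real span contains `Sym_J`, it is solvable in every direction of `Sym_J` (superpose), so —
with `W(Z₀) ≠ 0` and Weil-generic periods accumulating at `Q₀` — some Weil-generic positive definite `J`-commuting period carries an effective
tropical `n`-cycle with `W ≠ 0`. This is the finite certificate format of the `n`-dimensional calibration (integer linear systems when `Z₀`, `Q₀`
and the `E_i` are rational). [cite: Zharkov2020TropicalWeil, §1–2 (pp. 2–4)] -/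
theorem exists_weilGeneric_weilFunctional_ne_zero_of_sections_on_spanning_family {n : ℕ}
    {Q₀ : Matrix (Fin (2 * n)) (Fin (2 * n)) ℝ} (hQ₀S : Q₀.IsSymm) (hQ₀J : Q₀ * weilJ n = weilJ n * Q₀)
    (hacc : ∀ U : Set (Matrix (Fin (2 * n)) (Fin (2 * n)) ℝ), IsOpen U → Q₀ ∈ U →
      ∃ Q ∈ U, Q.PosDef ∧ Q * weilJ n = weilJ n * Q ∧ IsWeilGeneric n Q)
    (Z₀ : TropicalTorusCycle (2 * n) n Q₀) (hW : weilFunctional Z₀ ≠ 0)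
    {ι : Type*} [Fintype ι] (E : ι → Matrix (Fin (2 * n)) (Fin (2 * n)) ℝ)
    (hspan : ∀ D : Matrix (Fin (2 * n)) (Fin (2 * n)) ℝ, D.IsSymm → D * weilJ n = weilJ n * D →
      D ∈ Submodule.span ℝ (Set.range E))
    (v : ι → Fin Z₀.numCells → Fin (n + 1) → Fin (2 * n) → ℝ)
    (T : ι → Fin Z₀.numCells → Matrix (Fin n) (Fin n) ℝ)
    (r : ι → Fin Z₀.numFacetClasses → Fin n → Fin (2 * n) → ℝ)
    (hv : ∀ (i : ι) (σ : Fin Z₀.numCells) (j : Fin n) (a : Fin (2 * n)),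
      v i σ j.succ a - v i σ 0 a = ∑ m, ((Z₀.cell σ).frame a m : ℝ) * T i σ m j)
    (hr : ∀ (i : ι) (σ : Fin Z₀.numCells) (i' : Fin (n + 1)) (j : Fin n) (a : Fin (2 * n)),
      v i σ (i'.succAbove (Z₀.facetPerm σ i' j)) a =
        r i (Z₀.facetClass σ i') j a + ∑ b, E i a b * (Z₀.facetShift σ i' b : ℝ)) :
    ∃ Q : Matrix (Fin (2 * n)) (Fin (2 * n)) ℝ, Q.PosDef ∧ Q * weilJ n = weilJ n * Q ∧ IsWeilGeneric n Q ∧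
      ∃ Z : TropicalTorusCycle (2 * n) n Q, Z.numCells = Z₀.numCells ∧ weilFunctional Z ≠ 0 := by
  classical
  apply exists_weilGeneric_weilFunctional_ne_zero_of_unobstructedSeed hQ₀S hQ₀J hacc Z₀ hW
  intro D hDS hDJ
  obtain ⟨c, hc⟩ := (Submodule.mem_span_range_iff_exists_fun ℝ).1 (hspan D hDS hDJ)
  refine ⟨fun σ j a => ∑ i, c i * v i σ j a, fun σ => ∑ i, c i • T i σ,
    fun f j a => ∑ i, c i * r i f j a, ?_, ?_⟩
  · intro σ j a
    have e : ∀ m, (∑ i, c i • T i σ) m j = ∑ i, c i * T i σ m j := fun m => by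
      simp only [Matrix.sum_apply, Matrix.smul_apply, smul_eq_mul]
    simp_rw [e]
    rw [← Finset.sum_sub_distrib]
    simp_rw [← mul_sub, hv, Finset.mul_sum]
    rw [Finset.sum_comm]
    exact Finset.sum_congr rfl fun m _ => Finset.sum_congr rfl fun i _ => by ring
  · intro σ i' j a
    have eD : ∀ b, D a b = ∑ i, c i * E i a b := fun b => by
      rw [← hc]; simp only [Matrix.sum_apply, Matrix.smul_apply, smul_eq_mul]
    simp_rw [hr, mul_add, Finset.sum_add_distrib, eD, Finset.sum_mul, Finset.mul_sum]
    congr 1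
    rw [Finset.sum_comm]
    exact Finset.sum_congr rfl fun b _ => Finset.sum_congr rfl fun i _ => by ring

end Summit.HodgeConjecture.HodgeConjecture.Theorems.TropicalWeilVanishing

end
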